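import Summits.QuantumFields.YangMills.Theorems.BalabanUVNodesN15PerCubeGreenSopCoarseGeometry
import HarnessLib

/-!
# N15 = NE2, road (c) — PROGRAMME (PC), (PC-D) «the per-cube LANDAU LETTER», VII: THE FAR ZONE WITH MARGIN ON THE WHOLE INPUT-CUT BOX — n15-c∕299b's `exists_farZone` with (iii) the
# margin `d_Z ≥ w` on EVERY block of the knit's input-cut box `c(2w, k₀) + [0, 6w+1)^{d+1}` (not only on `supp h_{k₀}`), the far zone `Z = 𝕋 ∖ (c(4w−1, k₀) + [0, 10w−1))`, and (iv) the
# near cubes' three-collar boxes inside `c(Lw + 6w − m₀, k₀) + [0, Lw + 16w + 2)^{d+1}` (`L ≥ 17` odd, `w = L^m ≥ 2`) (dag-n15-c g29, n15-c∕312)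

Cell `pub-ymgap`, seat `pub-ymgap-dag-n15-c` (generation g29; R134 (a), s1; HUMAN RULING D-0062).  `bears_on: R4∕N15 · K3⁸ SpineGivenEndpointR13SepCoPHV (stmt-QuantumFields-27366)`;
filed `--kind proof --supports stmt-QuantumFields-27366 --as helper` — COUNT-NEUTRAL.  One theorem, 0 `def`, 0 `sorry`; elementary (`ZMod` bookkeeping).  Imports n15-c∕299b
`…PerCubeGreenSopCoarseGeometry` (`exists_distMinorant`, `val_sub_corner_lt`; through it FILE 72 `margin_le_tdistT_side`, FILE 66's `coverCorner`∕`cubeBlocks`∕`mem_cubeBlocks`,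
`MP_succ_eq`).  (iv) is 299b's proof VERBATIM with the window numerals `m₂ = 2w+2`, `A = 6w+5`, `m_Z = 4w−1`, `C = 10w−1`, `m_B = Lw+6w−m₀`; (iii) is a MOVING WINDOW: for a block `y` of
the cut box the corner `c″ = y − (2w−1)` puts `y` in FILE 72's window `[w−1, 3w−1)` of `c″` and §2's three windows put `c″ + [0, 4w−1)` inside `B_Z`.  Nothing in the tree is modified.

WHY ((PC-D); located by this seat while packaging n15-c∕311).  The knit consumes the per-cube perturbation `N_V k` behind the INPUT CUT `χ_k` = indicator of the box `c(2w,k)+[0,6w+1)`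
(n15-c∕260 `scChi`, n15-c∕181 `cvChi`; 52's rows `hNVcut`∕`hfarN`), which is LARGER than `supp h_k`: the smallness weight `e^{−δd_Z}` of the Landau letter (n15-c∕310∕311) must therefore
be `≤ e^{−δw}` on the whole cut box — i.e. `B_Z(k) ⊇` cut box `+ w`.  The price: the near cubes' boxes fill `c(Lw+6w−m₀,k)+[0,Lw+16w+2)` (a proper box of the torus `2Lw` iff
`16w + 2 ≤ Lw`: `L ≥ 17`, `w ≥ 2`), on which the per-cube (3.35) datum is then ASKED (n15-c∕313).

WHAT.  ★★ `exists_farZone₃`: for every cube `k₀` there are `Z ⊆ 𝕋`, `d_Z` with (i) `d_Z ≤ dist(·, Z)` on `Z`, (ii) `0 ≤ d_Z`, Lipschitz, (iii) `d_Z(y) ≥ w` for every block `y` of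
`c(2w,k₀)+[0,6w+1)`, (iv) `cvSk k ⊄ Z ⟹ {x | B(x) ∈ c(2w+2,k)+[0,6w+5)} ⊆ {x | B(x) ∈ c(Lw+6w−m₀,k₀)+[0,Lw+16w+2)}`.

HONEST FRAMING ∕ LIMITS.  Elementary geometry of the MODEL cover (cube regions = half the torus, hence locality boxes close to the whole torus: the model's artefact, stated);
[B9] (3.87) p.409, (3.95)–(3.96) p.411, Cor. 3.8 p.410 cited for SHAPES ∕ MECHANISM only.  NE2⁺ NOT PRINTED, NOT proved; N15 of record untouched; K3⁸ OPEN; counts UNMOVED.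
Restate-immune (no Theses import).
-/

noncomputable section

open scoped BigOperators

namespace Summit.QuantumFields.YangMills.BalabanUVNodes.N15.Gluing

open Real
open Literature.MathematicalPhysics.QuantumFieldTheory.Balaban1983to89
open Literature.MathematicalPhysics.QuantumFieldTheory.Balaban1983to89.B5Prop11Plancherel (Tor fine unitVec)
open Literature.MathematicalPhysics.QuantumFieldTheory.Balaban1983to89.B5Block118 (up bpt)
open Literature.MathematicalPhysics.QuantumFieldTheory.Balaban1983to89.B6UnitTorusCarrier (unitTorusGeo)
open Literature.MathematicalPhysics.QuantumFieldTheory.King1986.Torus (blockOf val_blockOf tdistT tdistT_nonneg tdistT_symm tdistT_self tdistT_triangle)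
open Summit.QuantumFields.YangMills.BalabanUVNodes.N15.TwoGrid (cubeBlocks mem_cubeBlocks)

variable {d : ℕ}

section Cover

variable {L : ℕ} [NeZero L]

/-- ★★ **THE FAR ZONE OF A CUBE WITH MARGIN ON THE WHOLE INPUT-CUT BOX** (`L ≥ 17`, `w = L^m ≥ 2`): for every cube `k₀` of n15-c∕262's cover there are `Z ⊆ 𝕋` and `d_Z : 𝕋 → ℝ` with
(i) `d_Z(y) ≤ |y − z|_T` on `Z`, (ii) `0 ≤ d_Z`, `d_Z(y) ≤ |y − z|_T + d_Z(z)`, (iii) `d_Z(y) ≥ w` for EVERY block `y` of the input-cut box `c(2w, k₀) + [0, 6w+1)^{d+1}`, and (iv) every cube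
`k` whose region `cvSk k` is NOT inside `Z` has its three-collar box `{x | B(x) ∈ c(2w+2, k) + [0, 6w+5)}` inside `{x | B(x) ∈ c(Lw + 6w − m₀, k₀) + [0, Lw + 16w + 2)}`
(`Z = 𝕋 ∖ (c(4w−1, k₀) + [0, 10w−1))`).  The shape of [B9]'s localisation «□̃ ⊃ □» for the random walk (3.87)∕(3.95).
[cite: Balaban1985BackgroundPropagators, (3.87) p.409, (3.95)–(3.96) p.411, Cor. 3.8 p.410 (shape ∕ mechanism); Balaban1984PropagatorsII, p.239] -/
theorem exists_farZone₃ (hL : Odd L ∧ 1 < L) (hL17 : 17 ≤ L) (mv kk : ℕ) (hW2 : 2 ≤ L ^ mv) (k₀ : Fin (d + 1) → ZMod (2 * L)) :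
    ∃ (Z : Set (Tor (cvM d L mv kk hL))) (dZ : Tor (cvM d L mv kk hL) → ℝ),
      (∀ y z, z ∈ Z → dZ y ≤ (unitTorusGeo L kk (cvM d L mv kk hL)).dist y z) ∧ (∀ y, 0 ≤ dZ y) ∧
      (∀ y z, dZ y ≤ (unitTorusGeo L kk (cvM d L mv kk hL)).dist y z + dZ z) ∧
      (∀ y : Tor (cvM d L mv kk hL), y ∈ cubeBlocks (cvM d L mv kk hL) (coverCorner (cvM d L mv kk hL) (L ^ mv) L (2 * L ^ mv) k₀) (6 * L ^ mv + 1) → ((L ^ mv : ℕ) : ℝ) ≤ dZ y) ∧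
      (∀ k, ¬ (cvSk d L mv kk hL k ⊆ Z) →
        {x : ScX d L mv kk hL | blockOf (L ^ kk) (cvM d L mv kk hL) x ∈ cubeBlocks (cvM d L mv kk hL) (coverCorner (cvM d L mv kk hL) (L ^ mv) L (2 * L ^ mv + 2) k) (6 * L ^ mv + 5)} ⊆
        {x : ScX d L mv kk hL | blockOf (L ^ kk) (cvM d L mv kk hL) x ∈ cubeBlocks (cvM d L mv kk hL) (coverCorner (cvM d L mv kk hL) (L ^ mv) L (L * L ^ mv + 6 * L ^ mv - coverMargin L mv) k₀) (L * L ^ mv + 16 * L ^ mv + 2)}) := by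
  classical
  have hM : ∀ ν, cvM d L mv kk hL ν = 2 * L * L ^ mv := MP_succ_eq L mv kk hL
  have hw : 0 < L ^ mv := pow_pos (by omega) _
  have hq : 2 ≤ L := by omega
  set BZ : Finset (Tor (cvM d L mv kk hL)) := cubeBlocks (cvM d L mv kk hL) (coverCorner (cvM d L mv kk hL) (L ^ mv) L (4 * L ^ mv - 1) k₀) (10 * L ^ mv - 1) with hBZ
  set Z : Set (Tor (cvM d L mv kk hL)) := {z | z ∉ BZ} with hZdef
  obtain ⟨dZ, h1, h2, h3, -, h5⟩ := exists_distMinorant (M := cvM d L mv kk hL) Z (c := ((L ^ mv : ℕ) : ℝ)) (Nat.cast_nonneg _)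
  refine ⟨Z, dZ, fun y z hz => h1 y z hz, h2, fun y z => h3 y z, fun y hy => ?_, fun k hk => ?_⟩
  · -- (iii'): the margin `w` around the input-cut box inside `B_Z` — a moving window of FILE 72's `margin_le_tdistT_side` and §2's three windows
    have key : ∀ z, z ∈ Z → ((L ^ mv : ℕ) : ℝ) ≤ tdistT (cvM d L mv kk hL) y z := by
      intro z hz
      have hzB : z ∉ BZ := hz
      set c'' : Tor (cvM d L mv kk hL) := fun ν => ((((((y ν).val : ℕ) : ℤ)) - (2 * L ^ mv - 1 : ℕ) : ℤ) : ZMod ((cvM d L mv kk hL) ν)) with hc''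
      have hyc : ∀ ν, ((y - c'') ν).val = 2 * L ^ mv - 1 := by
        intro ν
        have e1 : (y - c'') ν = ((2 * L ^ mv - 1 : ℕ) : ZMod ((cvM d L mv kk hL) ν)) := by
          show y ν - c'' ν = _
          rw [hc'']
          push_cast
          rw [ZMod.natCast_zmod_val]
          ring
        rw [e1, ZMod.val_natCast_of_lt]
        rw [hM ν]
        have h7 : 7 * L ^ mv ≤ L * L ^ mv := Nat.mul_le_mul_right _ (by omega)
        have e2 : 2 * L * L ^ mv = 2 * (L * L ^ mv) := by ring
        rw [e2]; omega
      have hsub : ∀ z' : Tor (cvM d L mv kk hL), z' ∈ cubeBlocks (cvM d L mv kk hL) c'' (4 * L ^ mv - 1) → z' ∈ BZ := by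
        intro z' hz'
        rw [hBZ, mem_cubeBlocks]
        rw [mem_cubeBlocks] at hz'
        have hyν := (mem_cubeBlocks _).1 hy
        intro ν
        have key := val_sub_corner_lt (N := (cvM d L mv kk hL) ν) (Kk := (((y ν).val : ℕ) : ℤ)) (K₀ := ((L ^ mv : ℕ) : ℤ) * (((k₀ ν).val : ℤ)) - ((L ^ mv : ℕ) : ℤ))
          (m₂ := 2 * L ^ mv - 1) (mK := 0) (mZ := 2 * L ^ mv) (mB := 4 * L ^ mv - 1)
          (A := 4 * L ^ mv - 1) (B := 1) (C := 6 * L ^ mv + 1) (b := z' ν) (y₀ := y ν) (hz' ν) ?_ ?_ (by omega)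
          (by rw [hM ν]; have h7 : 7 * L ^ mv ≤ L * L ^ mv := Nat.mul_le_mul_right _ (by omega); have e2 : 2 * L * L ^ mv = 2 * (L * L ^ mv) := (by ring); omega)
        · have e : 4 * L ^ mv - 1 + 1 + (6 * L ^ mv + 1) - 2 = 10 * L ^ mv - 1 := by omega
          rw [e] at key
          exact key
        · have e0 : ((((((y ν).val : ℕ) : ℤ)) - (0 : ℕ) : ℤ) : ZMod ((cvM d L mv kk hL) ν)) = y ν := by
            push_cast
            rw [ZMod.natCast_zmod_val]
            ring
          rw [e0, sub_self, ZMod.val_zero]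
          exact Nat.one_pos
        · exact hyν ν
      have hzc : z ∉ cubeBlocks (cvM d L mv kk hL) c'' (4 * L ^ mv - 1) := fun h => hzB (hsub z h)
      have hmar := margin_le_tdistT_side (m₀ := L ^ mv - 1) (S := 4 * L ^ mv - 1) hM (by omega)
        (by have h7 : 7 * L ^ mv ≤ L * L ^ mv := Nat.mul_le_mul_right _ (by omega); have e2 : 2 * L * L ^ mv = 2 * (L * L ^ mv) := (by ring); omega)
        hzc (fun ν => ⟨by rw [hyc ν]; omega, by rw [hyc ν]; omega⟩)
      rw [tdistT_symm, Nat.cast_sub (by omega), Nat.cast_one, sub_add_cancel] at hmar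
      exact hmar
    rw [h5 _ key]
  · -- (iv): a witness block in `cvSk k ∩ B_Z(k₀)` and the three windows
    obtain ⟨y₀, hy₀k, hy₀Z⟩ := Set.not_subset.1 hk
    have hy₀B : y₀ ∈ BZ := by by_contra h; exact hy₀Z h
    intro x hx
    simp only [Set.mem_setOf_eq, mem_cubeBlocks] at hx ⊢
    have hs := (mem_cubeBlocks _).1 (Finset.mem_coe.1 hy₀k)
    have hr := (mem_cubeBlocks _).1 hy₀B
    intro ν
    have hm₀ : coverMargin L mv ≤ L * L ^ mv := by
      unfold coverMargin
      have : (L - 2) * L ^ mv ≤ L * L ^ mv := Nat.mul_le_mul_right _ (Nat.sub_le _ _)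
      omega
    have key := val_sub_corner_lt (N := cvM d L mv kk hL ν) (Kk := (L ^ mv : ℤ) * (((k ν).val : ℤ)) - (L ^ mv : ℕ)) (K₀ := (L ^ mv : ℤ) * (((k₀ ν).val : ℤ)) - (L ^ mv : ℕ))
      (m₂ := 2 * L ^ mv + 2) (mK := coverMargin L mv) (mZ := 4 * L ^ mv - 1) (mB := L * L ^ mv + 6 * L ^ mv - coverMargin L mv)
      (A := 6 * L ^ mv + 5) (B := L * L ^ mv) (C := 10 * L ^ mv - 1) (b := blockOf (L ^ kk) (cvM d L mv kk hL) x ν) (y₀ := y₀ ν) ?_ ?_ ?_ (by omega) (by rw [hM ν]; have h17 : 17 * L ^ mv ≤ L * L ^ mv := Nat.mul_le_mul_right _ hL17; have e2 : 2 * L * L ^ mv = 2 * (L * L ^ mv) := (by ring); omega)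
    · have e : 6 * L ^ mv + 5 + L * L ^ mv + (10 * L ^ mv - 1) - 2 = L * L ^ mv + 16 * L ^ mv + 2 := by omega
      rw [e] at key
      convert key using 3
      simp only [coverCorner]; push_cast; ring_nf
    · convert hx ν using 3
      simp only [coverCorner]; push_cast; ring_nf
    · convert hs ν using 3
      simp only [coverCorner]; push_cast; ring_nf
    · convert hr ν using 3
      simp only [coverCorner]; push_cast; ring_nf

end Cover

end Summit.QuantumFields.YangMills.BalabanUVNodes.N15.Gluing

end
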